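import Summits.BirchSwinnertonDyer.BirchSwinnertonDyer.Theses.RamifiedHeegnerPair
import Summits.BirchSwinnertonDyer.BirchSwinnertonDyer.Theorems.RamifiedHeegnerPairRamifiedPairUpperBoundOfUpperHalfOverK
import Literature.NumberTheory.EllipticCurves.Rank1Residual.Typed.Basic
import HarnessLib

-- D-0017: single-problem summit, so `Summit.BirchSwinnertonDyer.BirchSwinnertonDyer.…` repeats a namespace BY DESIGN.
set_option linter.dupNamespace false
set_option autoImplicit false

noncomputable section

open scoped Classical

/-!
# Line `birth` for crux X1 `RamifiedPairLowerBound` (stmt-BirchSwinnertonDyer-23191) — skeleton v3 (lead rhp-p1 g2)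

RESHAPED from v2 (rhp-p1 g0, sha16 e61b68eba168af3d: stubs `stub_pub` [5 displayed PUB facts] + `stub_lowerHalfOverK`
[load-bearing: the lower half of `BSD₃(W_K/K)` over the 3-ramified `K = ℚ(√d)`], ended `promote-stub`). v2's over-`K`
stub is EQUIVALENT to the crux modulo the displayed published inputs (p598811 + p600026), so it was the crux restated
over `K`, not a cut. v3 CUTS it along the one seam the arithmetic offers over `ℚ`: X1's conclusion at `(W, V)` is the
SUM of the two members' one-sided lower halves `Typed.MissingLowerBoundAt · 3` (`ord₃ Ш_an ≤ ord₃ #Ш`), and the two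
members are of different kinds —

* the PARTNER `V` is GOOD supersingular at `3` with `r_an(V) ≤ 1`: its lower half (stub `stub_goodSSLowerAtThree`)
  is HALF OF THE ROUTE'S OWN RESIDUAL `GoodSupersingularAtThree` (item 23193, bound as `hR` in `closes`), derived
  from it + GZK in the landed `RamifiedPairLowerBound.goodSSLowerAtThree_of_goodSupersingularAtThree` (p606339) —
  so inside the route this stub costs nothing new;
* the ADDITIVE member `W = V₁ ⊗ χ₋₃` (Kodaira `I₀*`, `V₁` good supersingular at `3`) in analytic rank `0`
  (stub `stub_gssLowerAtThree_rankZero`) = Kato's main conjecture 12.10 for `(f_W, 3)` at an ADDITIVE `3`, read at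
  `T = 0`: ANNOUNCED on the Fouquet–Wan locus (arXiv:2107.13726 Thm. 5.1 / Cor. 5.4, PRE; tree binders
  `FouquetWan2021.cor54_pPart_rankZero_OPEN` / `thm51_etaKatoMC_OPEN` are typed for a GOOD `p` / the `η`-component
  and would need the any-reduction reading), nothing in print off it; census (N < 5·10⁵): 705 classes, 366 intrinsic
  (every `ℚ`-isogenous member has `3 ∣ #Ш_an`), of which 273 on the FW locus and 93 off it;
* the ADDITIVE member in analytic rank `1` (stub `stub_gssLowerAtThree_rankOne`, LOAD-BEARING) = a `3`-adic
  Gross–Zagier formula on the `ω`-branch of `V₁` at `3` (route QBSC's declared residual `PAdicGrossZagierBranch` read at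
  `p = 3`) or, equivalently over `K`, the signed anticyclotomic main conjecture `⊇` at the RAMIFIED prime (`e = 2 = p − 1`;
  Kriz 2021 / BKNO 2026 are the nearest, CM or non-Iwasawa): NOTHING in print; census: 355 classes, 9 intrinsic
  (`#Ш_an = 9` numerically: 133956n, 169848k, 182853c, 205128l, 228897c, 250065g, 355338h, 409248cy, 439794p).

`RamifiedPairLowerBound_of` concludes the crux BY NAME from the three stubs; it is the landed
`RamifiedPairLowerBound.ramifiedPairLowerBound_of_gssLowerHalves` (p606339), INLINED here so that this workfile
elaborates before that module is built on the farm. Cassels transport to the intrinsic classes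
(`gssLowerAtThree_of_intrinsicRows`, p606339) is available to every stub worker. BSD is not proved by any of this.
-/

namespace Summit.BirchSwinnertonDyer.BirchSwinnertonDyer.Cruxes.RamifiedPairLowerBound.Birth

open Summit.BirchSwinnertonDyer.BirchSwinnertonDyer.Theses.RamifiedHeegnerPair
open WeierstrassCurve Literature.NumberTheory.EllipticCurves Literature.NumberTheory.EllipticCurves.Rank1Residual
  Literature.NumberTheory.EllipticCurves.Rank1Residual.Typed Summit.BirchSwinnertonDyer.Rank1Residual.Additive

/-! ### The stub statements (named `Sig.stub_*`, so that `RamifiedPairLowerBound_of` takes them BY NAME — last name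
component = the stub's; the registered `stub_*` theorems below restate them UNFOLDED so that Theorems files match by
name + signature) -/

/-- Statement of `stub_gssLowerAtThree_rankZero` (L₀): the lower half of `BSD₃` over `ℚ` for every non-CM globally
minimal `W` additive of class Gss2 at `3` with `r_an(W) = 0`. -/
def Sig.stub_gssLowerAtThree_rankZero : Prop :=
  ∀ (W : WeierstrassCurve ℚ) [W.IsElliptic] [W.IsGloballyMinimal],
    ¬ W.HasCM → Literature.NumberTheory.EllipticCurves.Rank1Residual.Addv W 3 →
    Summit.BirchSwinnertonDyer.Rank1Residual.Additive.SubGss W 3 → W.analyticRank = 0 →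
    Literature.NumberTheory.EllipticCurves.Rank1Residual.Typed.MissingLowerBoundAt W 3

/-- Statement of `stub_gssLowerAtThree_rankOne` (L₁, LOAD-BEARING): the same in analytic rank `1`. -/
def Sig.stub_gssLowerAtThree_rankOne : Prop :=
  ∀ (W : WeierstrassCurve ℚ) [W.IsElliptic] [W.IsGloballyMinimal],
    ¬ W.HasCM → Literature.NumberTheory.EllipticCurves.Rank1Residual.Addv W 3 →
    Summit.BirchSwinnertonDyer.Rank1Residual.Additive.SubGss W 3 → W.analyticRank = 1 →
    Literature.NumberTheory.EllipticCurves.Rank1Residual.Typed.MissingLowerBoundAt W 3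

/-- Statement of `stub_goodSSLowerAtThree` (L_V): the lower half of `BSD₃` over `ℚ` for every non-CM globally minimal
`V` with GOOD supersingular reduction at `3` and `r_an(V) ≤ 1` (half of the route's residual item 23193). -/
def Sig.stub_goodSSLowerAtThree : Prop :=
  ∀ (V : WeierstrassCurve ℚ) [V.IsElliptic] [V.IsGloballyMinimal],
    ¬ V.HasCM → Literature.NumberTheory.EllipticCurves.Rank1Residual.GoodSS V 3 → V.analyticRank ≤ 1 →
    Literature.NumberTheory.EllipticCurves.Rank1Residual.Typed.MissingLowerBoundAt V 3

/-- STUB L₀ (rank-zero additive member): for every non-CM globally minimal `W/ℚ` additive of class Gss2 at `3`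
(`W = V₁ ⊗ χ₋₃`, `V₁` good supersingular at `3`) with `ord_{s=1} L(W,s) = 0`, `#Ш_an(W)` is a rational `q` with
`ord₃ q ≤ ord₃ #Ш(W)`. Kato's main conjecture 12.10 for `(f_W, 3)` at `T = 0`; announced on the Fouquet–Wan locus
(PRE), open off it. -/
theorem stub_gssLowerAtThree_rankZero :
    ∀ (W : WeierstrassCurve ℚ) [W.IsElliptic] [W.IsGloballyMinimal],
      ¬ W.HasCM → Literature.NumberTheory.EllipticCurves.Rank1Residual.Addv W 3 →
      Summit.BirchSwinnertonDyer.Rank1Residual.Additive.SubGss W 3 → W.analyticRank = 0 →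
      Literature.NumberTheory.EllipticCurves.Rank1Residual.Typed.MissingLowerBoundAt W 3 := by
  sorry

/-- STUB L₁ (rank-one additive member, LOAD-BEARING): for every non-CM globally minimal `W/ℚ` additive of class
Gss2 at `3` with `ord_{s=1} L(W,s) = 1`, `#Ш_an(W)` is a rational `q` with `ord₃ q ≤ ord₃ #Ш(W)`. A `3`-adic
Gross–Zagier formula on the `ω`-branch / the signed anticyclotomic main conjecture `⊇` over the 3-ramified `K`;
nothing in print. -/
theorem stub_gssLowerAtThree_rankOne :
    ∀ (W : WeierstrassCurve ℚ) [W.IsElliptic] [W.IsGloballyMinimal],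
      ¬ W.HasCM → Literature.NumberTheory.EllipticCurves.Rank1Residual.Addv W 3 →
      Summit.BirchSwinnertonDyer.Rank1Residual.Additive.SubGss W 3 → W.analyticRank = 1 →
      Literature.NumberTheory.EllipticCurves.Rank1Residual.Typed.MissingLowerBoundAt W 3 := by
  sorry

/-- STUB L_V (good supersingular partner): for every non-CM globally minimal `V/ℚ` with good supersingular reduction
at `3` and `ord_{s=1} L(V,s) ≤ 1`, `#Ш_an(V)` is a rational `q` with `ord₃ q ≤ ord₃ #Ш(V)`. Half of the route's
DECLARED residual `GoodSupersingularAtThree` (23193): inside `closes` it follows from `hR` + GZK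
(`RamifiedPairLowerBound.goodSSLowerAtThree_of_goodSupersingularAtThree`, p606339). -/
theorem stub_goodSSLowerAtThree :
    ∀ (V : WeierstrassCurve ℚ) [V.IsElliptic] [V.IsGloballyMinimal],
      ¬ V.HasCM → Literature.NumberTheory.EllipticCurves.Rank1Residual.GoodSS V 3 → V.analyticRank ≤ 1 →
      Literature.NumberTheory.EllipticCurves.Rank1Residual.Typed.MissingLowerBoundAt V 3 := by
  sorry

/-- The kernel-checked composition BY NAME: the three registered stubs give the route crux `RamifiedPairLowerBound`
(type literally the route decl) — the landed `RamifiedPairLowerBound.ramifiedPairLowerBound_of_gssLowerHalves`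
(p606339), inlined: the partner of a non-CM `W` is non-CM (`RamifiedPairUpperBound.not_hasCM_of_smul_quadraticTwist_eq`,
p601388), `r_an(W) + r_an(V) = 1` forces `r_an(W) ∈ {0,1}` and `r_an(V) ≤ 1`, and the two lower halves add up. -/
theorem RamifiedPairLowerBound_of (h0 : Sig.stub_gssLowerAtThree_rankZero) (h1 : Sig.stub_gssLowerAtThree_rankOne)
    (hV : Sig.stub_goodSSLowerAtThree) :
    Summit.BirchSwinnertonDyer.BirchSwinnertonDyer.Theses.RamifiedHeegnerPair.RamifiedPairLowerBound := by
  intro W _ _ V _ _ d hCM hadd hsub hd _hv _hsq hC hss hsum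
  have hrV : V.analyticRank ≤ 1 := by omega
  obtain ⟨C, hC⟩ := hC
  have hd0 : (d : ℚ) ≠ 0 := by exact_mod_cast hd.ne
  have hCMV : ¬ V.HasCM :=
    Summit.BirchSwinnertonDyer.BirchSwinnertonDyer.Theorems.RamifiedPairUpperBound.not_hasCM_of_smul_quadraticTwist_eq
      hd0 hC hCM
  have hW : MissingLowerBoundAt W 3 := by
    rcases Nat.le_one_iff_eq_zero_or_eq_one.mp (show W.analyticRank ≤ 1 by omega) with hr0 | hr1
    · exact h0 W hCM hadd hsub hr0
    · exact h1 W hCM hadd hsub hr1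
  obtain ⟨q, hq, hleW⟩ := hW
  obtain ⟨q', hq', hleV⟩ := hV V hCMV hss hrV
  exact ⟨q, q', hq, hq', by linarith⟩

/-- The crux from the (sorried) stubs — shows the skeleton is complete. -/
theorem RamifiedPairLowerBound_holds_of_stubs :
    Summit.BirchSwinnertonDyer.BirchSwinnertonDyer.Theses.RamifiedHeegnerPair.RamifiedPairLowerBound :=
  RamifiedPairLowerBound_of stub_gssLowerAtThree_rankZero stub_gssLowerAtThree_rankOne stub_goodSSLowerAtThree

end Summit.BirchSwinnertonDyer.BirchSwinnertonDyer.Cruxes.RamifiedPairLowerBound.Birth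

end
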